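import Literature.MathematicalPhysics.QuantumFieldTheory.Balaban1983to89.B8Eq142KLevelLocal

/-!
# `Balaban1983to89.B8Eq142KLevelTouching` — [Balaban1985RegularSpaces] the (1.42)/(1.37) clause «Q_j(U₀, ηA) = B on Λ_j, |B| < 2dLα₁»
# (p. 83 / p. 82) at `k` levels on the concrete `ℤᵈ` carriers FROM (1.35) ON THE LAYERS ONLY — `B8Eq142KLevelLocal.H42_of_inAx` with its
# closeness hypothesis weakened from the box form («every level-j bond with box in Ω_j», = (1.66)₁) to print's (1.35) «on Λ_j» (bonds
# TOUCHING `Λ_j`, p. 77 convention)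

statement-level skeleton of published theorems with citation tags; proofs where landed; nothing here is a claim about the
Yang–Mills mass gap

PDF held: `paper:balaban1985-cmp99-regular-spaces-gauge-fixing` (journal page = PDF page + 74); p. 77 (bond convention), p. 82 ((1.35), (1.37)),
p. 83 ((1.42)), p. 87 ((1.65)–(1.66)).

WHY THIS FILE (cell `pub-ymgap`, seat `pub-ymgap-dag-n05-a` g6, KNIT seat of DAG node N05 = [B8]; chair ★★ R453 (C): the N05 count line cites
Theorem 2 AS PRINTED — (1.35) ON Λ_j — as a one-screen corollary next to `B8LeafModelZd3Thm2.thm2Printed_zd3_univ`; count-neutral).  In that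
corollary the (1.36)/(1.39) members follow from the (1.66)-typed instance through the descent (1.65) (`B8Ineq165AllLevels`) at the shifted
constant `11d²α₀ + α₁`; but print's (1.37) bound `|B| < 2dLα₁` carries Theorem 2's ORIGINAL `α₁` («B is given by formula (1.31) with … by the
assumption (1.35)», p. 82): it is read off (1.35) on `Λ_j` directly, not through (1.65).  n04-b's (1.42) lemma `H42_of_inAx` delivers
`‖Q_j(U₀, ηA′)(c)‖ < 2dLα₁` on the constraint bonds `c ∈ Λb j` but ASKS the box form; its proof, however, consumes the closeness only (i) at
`c` itself and (ii) on the bonds inside the block `B(c₋)` (resp. `B(c₊)`) of a crossing constraint bond — and by the classification `hclass`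
all of these TOUCH `Λ_j` (resp. `Λ_{j−1}`).  This file is that observation as a theorem: **`H42_of_inAx_touching`** = `H42_of_inAx` (single
structure `Λs`, `Λb`; its unused `Lan` and `A′ = 0`-off binders dropped) with `h135` in the touching form `BondTouches (Λs j) z μ → (box ⊂ Ω_j) → …`.  Proof =
n04-b's, verbatim up to the three closeness applications (by name: `norm_Qj_lt_interior_loc`, `norm_Qj_lt_crossing_loc`,
`norm_Qj_lt_crossing_mirrored_loc`, `B8Eq137QjEqB.norm_Qj_lt_interior_zero`, `B8Eq131Derivation.eq87_of_inAx_restr129`).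

HONEST SCOPE.  A hypothesis-weakening of a landed lemma, nothing else; windows as there.  Count-neutral; N05 NOT discharged; nothing
continuum / ℝ⁴ / OS / mass-gap / Clay.  Unit `pub-ymgap-dag-n05-a` (g6), 2026-08-26.
-/

noncomputable section

open NormedSpace

namespace Literature.MathematicalPhysics.QuantumFieldTheory.Balaban1983to89.B8Eq142KLevelTouching

open Complex (I)
open MatrixLog B7Prop1Explicit B7Prop2Explicit B7Prop1Local B7Eq92Concrete B7Eq99Concrete
open B7Prop3Flat (expCfg c3 insCfg)
open B7Prop4GeneralLevels (logCovIter)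
open B7Prop5Flat (bondsIn restr mem_bondsIn insCfg_restr_of_mem agreeOn_insCfg_restr BondIn)
open B7LocalityGeneral (logCovIter_congr)
open B7AvgGaugeCovariance (uLev)
open B8Ineq130 (tlo thi tlo_apply thi_apply)
open B8Ineq132 (InAk BondTouches pdevOn_lt_of_forall)
open B8Lemma1NonAbelian (mulCfg e_nonneg)
open B8Eq146AExpansion (iEta)
open B8Eq184Proof (cfgExp)
open B8Eq140Level (SideTouches sideTouches_of_bondTouches)
open B8Eq119TwistedAxial (InAx Restr129)
open B8Eq131Derivation (eq87_of_inAx_restr129)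
open B8Eq137QjEqB (norm_Qj_lt_interior_regular norm_Qj_lt_interior_zero)
open B8Ineq172Concrete (wrec_congr_tower)
open B8Thm2LogB (blockTop)
open B8Eq142KLevelLocal (norm_Qj_lt_interior_loc norm_Qj_lt_crossing_loc norm_Qj_lt_crossing_mirrored_loc inBox_box_of_blockBond
  inBox_box_of_blockBond_snd)

-- `Site` alone could resolve to the torus sites of `Setup.lean`; re-export the `ℤ^d` sites of `B7Prop1Explicit`.
export B7Prop1Explicit (Site)

variable {d : ℕ}

section General

variable {𝔸 : Type*} [CStarAlgebra 𝔸] [Nontrivial 𝔸]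

omit [Nontrivial 𝔸] in
/-- For `d ≥ 2` every direction has a different one (private plumbing, as in `B8Eq142KLevelLocal`). [folklore] -/
private theorem exists_ne_dir' (hd2 : 2 ≤ d) (μ : Fin d) : ∃ κ : Fin d, κ ≠ μ := by
  haveI : Nontrivial (Fin d) := Fin.nontrivial_iff_two_le.mpr hd2
  exact exists_ne μ

omit [Nontrivial 𝔸] in
/-- The two exponent-field spellings agree bondwise (private plumbing). [folklore] -/
private theorem expCfg_iEta_apply (η : ℝ) (A : Site d → Fin d → 𝔸) (x : Site d) (κ : Fin d) :
    expCfg (iEta η A) x κ = cfgExp η A x κ :=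
  congrFun (congrFun (B8Prop3GaugeFixedKLevel.expCfg_iEta_eq_cfgExp η A) x) κ

/-- **THE (1.42)/(1.37) CLAUSE AT `m` LEVELS FROM (1.35) ON THE LAYERS** — `B8Eq142KLevelLocal.H42_of_inAx` with the closeness hypothesis
in print's form: `‖(U′U₀)‾ʲ(c) − Ū₀ʲ(c)‖ ≤ α₁` only for the level-`j` bonds `c` TOUCHING `Λs j` (p. 77: at least one end-point in `Λ_j`) whose
box lies in `Ω_j`.  SETTING (one structure with `m` levels: regions `Ω` (antitone), constraint sites `Λs j`, classified constraint bonds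
`Λb j` — interior (both ends in `Λs j`), crossing (`c₊ ∈ Λs j`, the block `B(c₋)` of level-`(j−1)` constraint sites) or mirrored crossing —
with boxes in `Ω_j`): (1.33) `U₀ ∈ 𝔄_m`, (1.34) `U′U₀ ∈ 𝔄_m ∩ Ax_m(𝔅_m(Λs), U₀)`, (1.35) as said, the windows of [3] Prop. 4 at `α₂`
(`16α₂ ≤ 1`, the exponential window, `2α₂ ≤ c₃`), `dLα₁ ≤ 1/8`, `d, L ≥ 2`, `η > 0`, `U₀` unitary.  For a gauge-fixed datum `(u, W, A′)` —
`u` unitary-valued, `W^{u} = U′`, (1.29) `Restr129 L m Λs U₀ u`, `A′` Hermitian, `W = e^{iηA′}` with `‖A′‖ ≤ α₂(Lʲη)⁻¹` on the sides of the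
plaquettes touching `Ω_j` (the «`A′ = 0` elsewhere» binder of `H42_of_inAx` is not needed and dropped) —: `‖Q_j(U₀, ηA′)(c)‖ < 2dLα₁` for
every `c ∈ Λb j`, `j ≤ m`.  PROOF = `H42_of_inAx`'s: the
closeness is consumed at `c` itself (which touches `Λs j` in all three classes) and, for a crossing bond, on the bonds inside the block of
level-`(j−1)` constraint sites (which touch `Λs (j−1)` by their lower end). [cite: Balaban1985RegularSpaces, (1.42) p.83, (1.37) p.82, (1.35) p.82, p.77 (convention before (1.5)), (1.29) p.81, (1.19) p.79] -/
theorem H42_of_inAx_touching (hd2 : 2 ≤ d) {η : ℝ} (hη : 0 < η) {L : ℕ} (hL : 2 ≤ L) (m : ℕ)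
    {U₀ U' : Site d → Fin d → 𝔸ˣ} (hU₀ : ∀ x κ, U₀ x κ ∈ unitaryUnits 𝔸)
    {α₀ α₁ α₂ : ℝ} (hα₀ : 0 < α₀) (hα₁ : 0 < α₁) (hα₂ : 0 ≤ α₂)
    (hα3 : C0 d * α₀ ≤ 1 / 3) (hα4 : 4 * α₀ ≤ c2' d L) (h16 : 16 * α₂ ≤ 1)
    (hsmall : Real.exp (4 * (800 * ((d : ℝ) + 1) ^ 2 * ((d : ℝ) + 4)) * α₀) * (1 + 8 * (131072 * ((d : ℝ) + 1) ^ 2) * α₂) ≤ 2)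
    (hc₃ : 2 * α₂ ≤ c3 d L) (hsmall₁ : (d : ℝ) * L * α₁ ≤ 1 / 8)
    (Ω : ℕ → Set (Site d)) (hΩ : ∀ j, Ω (j + 1) ⊆ Ω j) (Λs : ℕ → Set (Site d)) (Λb : ℕ → Set (Site d × Fin d))
    (hbox : ∀ j, j ≤ m → ∀ c ∈ Λb j, ∀ x, InBox (loK L j c.1) (bondHiK L j c.1 c.2) x → x ∈ Ω j)
    (hclass : ∀ j, j ≤ m → ∀ c ∈ Λb j,
      (c.1 ∈ Λs j ∧ c.1 + e c.2 ∈ Λs j) ∨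
      (∃ j', j = j' + 1 ∧ (∀ x, (L : ℤ) • c.1 ≤ x → x ≤ (L : ℤ) • c.1 + blockTop L → x ∈ Λs j') ∧ c.1 + e c.2 ∈ Λs j) ∨
      (∃ j', j = j' + 1 ∧ c.1 ∈ Λs j ∧ (∀ x, (L : ℤ) • (c.1 + e c.2) ≤ x → x ≤ (L : ℤ) • (c.1 + e c.2) + blockTop L → x ∈ Λs j')))
    (h33 : InAk L m η α₀ Ω U₀) (h34 : InAk L m η α₀ Ω (mulCfg U' U₀)) (hAx : InAx L m Λs U₀ (mulCfg U' U₀))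
    (h135 : ∀ j, j ≤ m → ∀ (z : Site d) (μ : Fin d), BondTouches (Λs j) z μ →
      (∀ x, InBox (loK L j z) (bondHiK L j z μ) x → x ∈ Ω j) →
      ‖(avgIter L (mulCfg U' U₀) j z μ : 𝔸) - (avgIter L U₀ j z μ : 𝔸)‖ ≤ α₁)
    (u : Site d → 𝔸ˣ) (W : Site d → Fin d → 𝔸ˣ) (A' : Site d → Fin d → 𝔸)
    (hu : ∀ x, u x ∈ unitaryUnits 𝔸) (hW : mgauge U₀ u W = U') (h129 : Restr129 L m Λs U₀ u)
    (hsa : ∀ y τ, IsSelfAdjoint (A' y τ))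
    (hWA : ∀ j, j ≤ m → ∀ y τ, SideTouches (Ω j) y τ → W y τ = cfgExp η A' y τ ∧ ‖A' y τ‖ ≤ α₂ * ((L : ℝ) ^ j * η)⁻¹) :
    ∀ j, j ≤ m → ∀ c ∈ Λb j, ‖logCovIter L U₀ (iEta η A') j c.1 c.2‖ < 2 * d * L * α₁ := by
  intro j hj c hc
  have hL1 : 1 ≤ L := le_trans (by norm_num) hL
  have hd1 : 1 ≤ d := le_trans (by norm_num) hd2
  have hLr : (1 : ℝ) ≤ L := by exact_mod_cast hL1
  have hG : AvgClosed d L (unitaryUnits 𝔸) := avgClosed_unitaryUnits d L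
  have hu1 : ∀ x, u x ∈ U1 𝔸 := fun x => unitaryUnits_le_U1 (hu x)
  -- the field `WU₀` is `U′U₀`; its class `𝔄` by gauge invariance
  have hWU : mgauge U₀ u W * U₀ = mulCfg U' U₀ := by rw [hW]; rfl
  have h34W : InAk L m η α₀ Ω (mulCfg W U₀) := by
    have h1 : InAk L m η α₀ Ω (mulCfg U' U₀) := h34
    have hui : ∀ x, u⁻¹ x ∈ U1 𝔸 := fun x => unitaryUnits_le_U1 ((unitaryUnits 𝔸).inv_mem (hu x))
    rw [B8Prop3GaugeFixedKLevel.mulCfg_eq_gaugeAct_of_mgauge_eq hW]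
    exact (B8Ineq132.inAk_gaugeAct_iff L m η α₀ Ω hui _).2 h1
  -- (87) at all constraint sites, from (1.19)/(1.29)
  have h87 := eq87_of_inAx_restr129 L hL1 m Λs U₀ W u (by rw [hWU]; exact hAx) h129
  -- `e^{iηA′}` is unitary-valued
  have hBG : ∀ x μ, expCfg (iEta η A') x μ ∈ unitaryUnits 𝔸 := fun x μ => B8Eq155JBound.expCfg_iEta_mem_unitaryUnits η hsa x μ
  -- box data common to all cases, for the bond `c` at its level `j`
  have hboxbond : ∀ x μ, BondIn (loK L j c.1) (bondHiK L j c.1 c.2) x μ →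
      W x μ = cfgExp η A' x μ ∧ ‖iEta η A' x μ‖ ≤ α₂ * ((L : ℝ) ^ j)⁻¹ := by
    intro x μ hb
    obtain ⟨ν, hν⟩ := exists_ne_dir' hd2 μ
    have hs : SideTouches (Ω j) x μ := sideTouches_of_bondTouches hν (Or.inl (hbox j hj c hc x hb.1))
    obtain ⟨hWx, hAx'⟩ := hWA j hj x μ hs
    refine ⟨hWx, ?_⟩
    show ‖((I : ℂ) * η) • A' x μ‖ ≤ α₂ * ((L : ℝ) ^ j)⁻¹
    rw [norm_smul, norm_mul, Complex.norm_I, one_mul, Complex.norm_real, Real.norm_eq_abs, abs_of_pos hη]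
    calc η * ‖A' x μ‖ ≤ η * (α₂ * ((L : ℝ) ^ j * η)⁻¹) := mul_le_mul_of_nonneg_left hAx' hη.le
      _ = α₂ * ((L : ℝ) ^ j)⁻¹ := by field_simp
  have hag : AgreeOn (loK L j c.1) (bondHiK L j c.1 c.2) W (expCfg (iEta η A')) := fun x μ hx hxe => by
    rw [(hboxbond x μ ⟨hx, hxe⟩).1, expCfg_iEta_apply]
  have h40 : ∀ (x : Site d) (μ ν : Fin d), μ ≠ ν → PlaqIn (loK L j c.1) (bondHiK L j c.1 c.2) (x, μ, ν) →
      ‖((hol U₀ x (plaqWord μ ν) : 𝔸ˣ) : 𝔸) - 1‖ < α₀ * (((L : ℝ) ^ j)⁻¹) ^ 2 :=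
    fun x μ ν hμν hp => (h33 j hj).1 x μ ν hμν (Or.inl (hbox j hj c hc x hp.1))
  have h40' : ∀ (x : Site d) (μ ν : Fin d), μ ≠ ν → PlaqIn (loK L j c.1) (bondHiK L j c.1 c.2) (x, μ, ν) →
      ‖((hol (W * U₀) x (plaqWord μ ν) : 𝔸ˣ) : 𝔸) - 1‖ < α₀ * (((L : ℝ) ^ j)⁻¹) ^ 2 :=
    fun x μ ν hμν hp => (h34W j hj).1 x μ ν hμν (Or.inl (hbox j hj c hc x hp.1))
  -- the constraint bond `c` TOUCHES `Λ_j` (all three classes of `hclass`)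
  have htouch : BondTouches (Λs j) c.1 c.2 := by
    rcases hclass j hj c hc with ⟨hy, -⟩ | ⟨j', -, -, hyκ⟩ | ⟨j', -, hy, -⟩
    · exact Or.inl hy
    · exact Or.inr hyκ
    · exact Or.inl hy
  -- (1.35) at `c` and on sub-boxes
  have h135c : ‖(avgIter L (mgauge U₀ u W * U₀) j c.1 c.2 : 𝔸) - (avgIter L U₀ j c.1 c.2 : 𝔸)‖ ≤ α₁ := by
    rw [hWU]; exact h135 j hj c.1 c.2 htouch (hbox j hj c hc)
  rcases hclass j hj c hc with ⟨hy, hyκ⟩ | ⟨j', rfl, hblk, hyκ⟩ | ⟨j', rfl, hy, hblk⟩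
  · -- INTERIOR bond
    rcases j with _ | j
    · -- level 0
      have hb0 : BondIn (loK L 0 c.1) (bondHiK L 0 c.1 c.2) c.1 c.2 := by
        refine ⟨fun i => ?_, fun i => ?_⟩
        · simp only [loK, bondHiK, pow_zero, one_mul]; split_ifs <;> omega
        · simp only [loK, bondHiK, pow_zero, one_mul, add_e_apply]; split_ifs <;> omega
      obtain ⟨hWc, hAc⟩ := hboxbond c.1 c.2 hb0
      have hlog2 : ‖iEta η A' c.1 c.2‖ < Real.log 2 := by
        have := Real.log_two_gt_d9
        rw [pow_zero, inv_one, mul_one] at hAc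
        linarith
      have hm0 : uLev L u 0 c.1 = (wrec L U₀ (expCfg (iEta η A')) 0 c.1)⁻¹ := by
        rw [h87 0 (Nat.zero_le _) c.1 hy, wrec_zero, wrec_zero]
      have hp0 : uLev L u 0 (c.1 + e c.2) = (wrec L U₀ (expCfg (iEta η A')) 0 (c.1 + e c.2))⁻¹ := by
        rw [h87 0 (Nat.zero_le _) (c.1 + e c.2) hyκ, wrec_zero, wrec_zero]
      have h₀ : avgIter L U₀ 0 c.1 c.2 ∈ U1 𝔸 := by rw [avgIter_zero]; exact unitaryUnits_le_U1 (hU₀ _ _)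
      have h135' : ‖(avgIter L (mgauge U₀ u (expCfg (iEta η A')) * U₀) 0 c.1 c.2 : 𝔸) - (avgIter L U₀ 0 c.1 c.2 : 𝔸)‖ ≤ α₁ := by
        have hpt : (mgauge U₀ u (expCfg (iEta η A')) * U₀) c.1 c.2 = (mgauge U₀ u W * U₀) c.1 c.2 := by
          show mgauge U₀ u (expCfg (iEta η A')) c.1 c.2 * U₀ c.1 c.2 = mgauge U₀ u W c.1 c.2 * U₀ c.1 c.2
          rw [mgauge_apply, mgauge_apply, expCfg_iEta_apply, ← hWc]
        have h := h135c
        rw [avgIter_zero, avgIter_zero] at h ⊢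
        rw [hpt]
        exact h
      exact norm_Qj_lt_interior_zero L hd1 hL1 U₀ (iEta η A') u c.1 c.2 hlog2 hm0 hp0 h₀ hα₁ hsmall₁ h135'
    · -- level `j + 1`
      have hLb : (L : ℝ) ^ (j + 1) * (α₂ * ((L : ℝ) ^ (j + 1))⁻¹) = α₂ := by field_simp
      exact norm_Qj_lt_interior_loc L hd1 hL hG j U₀ c.1 c.2 hU₀ hα₀ hα3 hα4 h40 (iEta η A') (by positivity)
        (fun x μ hbd => (hboxbond x μ hbd).2) (by rw [hLb]; exact hsmall) (by rw [hLb]; exact hc₃) u W hag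
        (h87 (j + 1) hj c.1 hy) (h87 (j + 1) hj (c.1 + e c.2) hyκ) hα₁ hsmall₁ h135c
  · -- CROSSING bond at level `j' + 1`: the block `B(c₋)` consists of level-`j'` constraint sites
    have hLb : (L : ℝ) ^ (j' + 1) * (α₂ * ((L : ℝ) ^ (j' + 1))⁻¹) = α₂ := by field_simp
    refine norm_Qj_lt_crossing_loc L hd1 hL hG j' U₀ c.1 c.2 hU₀ hα₀ hα3 hα4 h40 (iEta η A') hBG (by positivity)
      (fun x μ hbd => (hboxbond x μ hbd).2) (by rw [hLb]; exact hsmall) (by rw [hLb]; exact hc₃) u hu1 W hag h40'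
      (fun x hx1 hx2 => h87 j' (by omega) x (hblk x hx1 hx2)) (h87 (j' + 1) hj (c.1 + e c.2) hyκ) hα₁ hsmall₁
      (fun z μ hz1 hz2 => ?_) h135c
    rw [hWU]
    refine h135 j' (by omega) z μ (Or.inl (hblk z hz1 ((le_add_of_nonneg_right (e_nonneg μ)).trans hz2)))
      fun x hx => hΩ j' (hbox (j' + 1) hj c hc x ?_)
    exact inBox_box_of_blockBond hL1 j' c.1 c.2 hz1 hz2 hx
  · -- MIRRORED crossing bond at level `j' + 1`: the block `B(c₊)` consists of level-`j'` constraint sites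
    have hLb : (L : ℝ) ^ (j' + 1) * (α₂ * ((L : ℝ) ^ (j' + 1))⁻¹) = α₂ := by field_simp
    refine norm_Qj_lt_crossing_mirrored_loc L hd1 hL hG j' U₀ c.1 c.2 hU₀ hα₀ hα3 hα4 h40 (iEta η A') hBG (by positivity)
      (fun x μ hbd => (hboxbond x μ hbd).2) (by rw [hLb]; exact hsmall) (by rw [hLb]; exact hc₃) u hu1 W hag h40'
      (h87 (j' + 1) hj c.1 hy) (fun x hx1 hx2 => h87 j' (by omega) x (hblk x hx1 hx2)) hα₁ hsmall₁
      (fun z μ hz1 hz2 => ?_) h135c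
    rw [hWU]
    refine h135 j' (by omega) z μ (Or.inl (hblk z hz1 ((le_add_of_nonneg_right (e_nonneg μ)).trans hz2)))
      fun x hx => hΩ j' (hbox (j' + 1) hj c hc x ?_)
    exact inBox_box_of_blockBond_snd hL1 j' c.1 c.2 hz1 hz2 hx

end General

#print axioms H42_of_inAx_touching

end Literature.MathematicalPhysics.QuantumFieldTheory.Balaban1983to89.B8Eq142KLevelTouching

end
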